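import Summits.ResolutionOfSingularities.ResolutionOfSingularities.Theorems.PurelyInseparableDim4ScopeDivEdge
import Summits.ResolutionOfSingularities.ResolutionOfSingularities.Theorems.PurelyInseparableDim4EquimultipleScope
import Summits.ResolutionOfSingularities.ResolutionOfSingularities.Theorems.PurelyInseparableDim4IsolatedCleaning
import Literature.AlgebraicGeometry.Resolution.PointBlowupMohBound
import Literature.AlgebraicGeometry.Resolution.PointBlowupKangaroo
import Mathlib.RingTheory.Ideal.MinimalPrime.Localization
import HarnessLib

/-!
# [OURS · res-dim4-pi · F4-C] SCOPE DYNAMICS, part 2c: the class of ANY edge child — in scope / out of scope /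
  isolated — is read on ONE ideal, `J_p⁺` of the CHART TRANSFORM, at the point `b`

Cell `res-dim4-pi` (D-0157 DOOR 2, wave 2), seat `res-dim4-p-6`, desk WORD #31 (c); sequel of
`PurelyInseparableDim4ScopeDivEdge` (spine DIV edges).  For EVERY centre `S`, chart `j` and point `b` the
child is `F′ = clean(G(x + b))` with `G = chartTransform p S j F`; cleaning is inert for `J_p⁺` (p-5's
`IsolatedBand.singLocusIdeal_deletePthPowers`) and Hasse derivatives commute with translations (tree
`hasseDeriv_translate` + typ's `Equimultiple.hasseDeriv_eq`), so

  `J_p⁺(F′) = τ_b(J_p⁺(G))`,  `τ_b : x ↦ x + b`   (`singLocusIdeal_step`, written as the `comap` along `τ_{−b}`),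

and the minimal primes of `J_p⁺(F′)` are the translates of those of `J_p⁺(G)` (`minimalPrimes_singLocusIdeal_step`).
Hence the **classification of the edge child by the components of `V(J_p⁺(G))` through `b`**:

* **`inCoordinateScope_step_iff_chart`** — the child is IN SCOPE iff every component of `V(J_p⁺(G))` through
  the point `b` is a `b`-coordinate subspace `b + V(x_T)` (`comap_translate_span_X`: the ideal
  `(x_i − b_i : i ∈ T)`); so the OUT-OF-SCOPE points of the new exceptional chart are exactly the points lying
  on a component of `V(J_p⁺(G))` that is not coordinate-parallel through them — one primary decomposition per
  chart decides all its children;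
* **`isIsolated_step_iff_chart`** — the child is ISOLATED iff `b ∈ V(J_p⁺(G))` and the only component through
  `b` is the point;
* `singLocusIdeal_step_origin` / `mem_minimalPrimes_chartTransform_iff_of_not_mem` — at `b = 0` this is
  `J_p⁺(G)` itself, and for a DIV edge (`S = {j}`) part 2a applies: off `V(x_j)` the components of `V(J_p⁺(G))`
  are the parent's.

MECHANISM of scope loss (K-P14-02 (r1), res-dim4-p-14): a clean `F = x_j^a · G` with `a ≥ p` has the components
of `V(x_j) ∩ V(J_p⁺`-data of `G)` EMBEDDED in the component `V(x_j)` of `V(J_p⁺(F))`; they SURFACE after the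
forced DIV steps along `{x_j}` have used up `x_j^a` (specimen `PurelyInseparableDim4ScopeLoss`: `a = 3`, `p = 2`,
one step).  ERRATUM (K-P14-02 (r2)): the curve certificate `IsolationCert.not_inCoordinateScope_two_of_powerSeriesCurve`
credited to p-14 in `PurelyInseparableDim4ScopeLoss` is res-dim4-p-3's (`…ScopeWitness` / `…IsolationCert` kit).

[OURS · counted 0 · elementary; AI kernel work, weaker than expert review.]  NOTHING here is a statement about
resolution of singularities; resolution in dimension `≥ 4` / characteristic `p > 0` is NOT proved by anything
in this file.  bears_on: LADDER-RESOLUTION:D157-DOOR2 (res-dim4-pi · F4-C SCOPE DYNAMICS).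
Host item (DR-157-C): `stmt-ResolutionOfSingularities-16155`.
-/

noncomputable section

set_option linter.dupNamespace false -- mandated namespace of this single-conjunct summit

open MvPolynomial Finset

namespace Summit.ResolutionOfSingularities.ResolutionOfSingularities.Theorems.PIDim4

namespace ScopeDynamics

open Literature.AlgebraicGeometry.Resolution
open Literature.AlgebraicGeometry.Resolution.CentreBlowup
open Literature.AlgebraicGeometry.Resolution.Hauser2010

variable {K : Type} [Field K]

/-! ## §1 Translations and the `q`-fold locus ideal (every `q`, every field) -/

/-- `translate c` is the substitution `xᵢ ↦ xᵢ + cᵢ` (definitional). -/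
theorem translate_def (c : Fin 4 → K) (G : MvPolynomial (Fin 4) K) :
    PointBlowup.translate c G = MvPolynomial.aeval (R := K) (fun i => (X i + C (c i) : MvPolynomial (Fin 4) K)) G :=
  rfl

/-- `τ_b ∘ τ_{−b} = id`. [folklore] -/
theorem translate_translate_neg (b : Fin 4 → K) (G : MvPolynomial (Fin 4) K) :
    PointBlowup.translate b (PointBlowup.translate (fun i => -b i) G) = G := by
  simpa using PointBlowup.translate_neg_translate (fun i => -b i) G

/-- `τ_{−b}` is surjective. [folklore] -/
theorem translate_neg_surjective (b : Fin 4 → K) :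
    Function.Surjective (MvPolynomial.aeval (R := K) (fun i => (X i + C (-b i) : MvPolynomial (Fin 4) K))) :=
  fun x => ⟨PointBlowup.translate b x, PointBlowup.translate_neg_translate b x⟩

/-- **The frame's Hasse derivatives commute with translations.** [cite: EGAIV4, Thm. 16.11.2 (16.11.2.1)] -/
theorem hasseDeriv_translate (b : Fin 4 → K) (α : Fin 4 →₀ ℕ) (G : MvPolynomial (Fin 4) K) :
    PIDim4.hasseDeriv α (PointBlowup.translate b G) = PointBlowup.translate b (PIDim4.hasseDeriv α G) := by
  rw [Equimultiple.hasseDeriv_eq, Equimultiple.hasseDeriv_eq]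
  exact Literature.AlgebraicGeometry.Resolution.hasseDeriv_translate b α G

/-- **`J_q⁺(G(x + b)) = τ_b(J_q⁺(G))`**, written as the pull-back along `τ_{−b}`. [folklore] -/
theorem singLocusIdeal_translate (q : ℕ) (b : Fin 4 → K) (G : MvPolynomial (Fin 4) K) :
    singLocusIdeal q (PointBlowup.translate b G) =
      (singLocusIdeal q G).comap
        (MvPolynomial.aeval (R := K) (fun i => (X i + C (-b i) : MvPolynomial (Fin 4) K))) := by
  apply le_antisymm
  · unfold singLocusIdeal
    rw [Ideal.span_le]
    rintro _ ⟨α, h0, hq, rfl⟩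
    rw [SetLike.mem_coe, Ideal.mem_comap, hasseDeriv_translate, ← translate_def,
      PointBlowup.translate_neg_translate]
    exact Ideal.subset_span ⟨α, h0, hq, rfl⟩
  · intro x hx
    rw [Ideal.mem_comap, ← translate_def] at hx
    have hmap : (singLocusIdeal q G).map
        (MvPolynomial.aeval (R := K) (fun i => (X i + C (b i) : MvPolynomial (Fin 4) K))) ≤
          singLocusIdeal q (PointBlowup.translate b G) := by
      unfold singLocusIdeal
      rw [Ideal.map_span, Ideal.span_le]
      rintro _ ⟨_, ⟨α, h0, hq, rfl⟩, rfl⟩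
      refine Ideal.subset_span ⟨α, h0, hq, ?_⟩
      rw [hasseDeriv_translate, translate_def]
    rw [← translate_translate_neg b x, translate_def b]
    exact hmap (Ideal.mem_map_of_mem _ hx)

/-- Minimal primes move with the translation. [folklore] -/
theorem minimalPrimes_singLocusIdeal_translate (q : ℕ) (b : Fin 4 → K) (G : MvPolynomial (Fin 4) K) :
    (singLocusIdeal q (PointBlowup.translate b G)).minimalPrimes =
      Ideal.comap (MvPolynomial.aeval (R := K) (fun i => (X i + C (-b i) : MvPolynomial (Fin 4) K))) ''
        (singLocusIdeal q G).minimalPrimes := by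
  rw [singLocusIdeal_translate]
  exact Ideal.comap_minimalPrimes_eq_of_surjective (translate_neg_surjective b) _

/-- `G(b) = ` the constant term of `τ_{b}G`, read through `τ_{−b}`: `eval b (τ_{−b} x) = constantCoeff x`. -/
theorem eval_translate_neg (b : Fin 4 → K) (x : MvPolynomial (Fin 4) K) :
    MvPolynomial.eval b (PointBlowup.translate (fun i => -b i) x) = constantCoeff x := by
  rw [← Equimultiple.coeff_zero_translate b, translate_translate_neg]
  rfl

/-- **`τ_b(Q)` passes through the origin iff `Q` passes through `b`**: `Q.comap τ_{−b} ≤ 𝔪₀ ↔ Q ≤ 𝔪_b`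
(`𝔪_b = ker (eval b)`). [folklore] -/
theorem comap_translate_neg_le_originIdeal_iff (b : Fin 4 → K) (Q : Ideal (MvPolynomial (Fin 4) K)) :
    Q.comap (MvPolynomial.aeval (R := K) (fun i => (X i + C (-b i) : MvPolynomial (Fin 4) K))) ≤ originIdeal K ↔
      Q ≤ RingHom.ker (MvPolynomial.eval b) := by
  constructor
  · intro h y hy
    have hy' : PointBlowup.translate b y ∈
        Q.comap (MvPolynomial.aeval (R := K) (fun i => (X i + C (-b i) : MvPolynomial (Fin 4) K))) := by
      rw [Ideal.mem_comap, ← translate_def, PointBlowup.translate_neg_translate]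
      exact hy
    have h0 := IsolatedScope.mem_originIdeal_iff.mp (h hy')
    rw [RingHom.mem_ker, ← Equimultiple.coeff_zero_translate b y]
    exact h0
  · intro h x hx
    rw [Ideal.mem_comap, ← translate_def] at hx
    have := h hx
    rw [RingHom.mem_ker, eval_translate_neg] at this
    exact IsolatedScope.mem_originIdeal_iff.mpr this

/-- `𝔪_b` pulls back to `𝔪₀` along `τ_{−b}`. [folklore] -/
theorem comap_translate_neg_ker_eval (b : Fin 4 → K) :
    (RingHom.ker (MvPolynomial.eval b)).comap
        (MvPolynomial.aeval (R := K) (fun i => (X i + C (-b i) : MvPolynomial (Fin 4) K))) = originIdeal K := by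
  ext x
  rw [Ideal.mem_comap, RingHom.mem_ker, ← translate_def, eval_translate_neg, IsolatedScope.mem_originIdeal_iff]

/-- `comap τ_{−b}` is injective on ideals. [folklore] -/
theorem comap_translate_neg_injective (b : Fin 4 → K) :
    Function.Injective (Ideal.comap
      (MvPolynomial.aeval (R := K) (fun i => (X i + C (-b i) : MvPolynomial (Fin 4) K))) :
        Ideal (MvPolynomial (Fin 4) K) → Ideal (MvPolynomial (Fin 4) K)) :=
  Ideal.comap_injective_of_surjective _ (translate_neg_surjective b)

/-- `comap τ_{−b}` and `comap τ_b` are inverse to each other. [folklore] -/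
theorem comap_translate_comap_translate_neg (b : Fin 4 → K) (Q : Ideal (MvPolynomial (Fin 4) K)) :
    (Q.comap (MvPolynomial.aeval (R := K) (fun i => (X i + C (-b i) : MvPolynomial (Fin 4) K)))).comap
        (MvPolynomial.aeval (R := K) (fun i => (X i + C (b i) : MvPolynomial (Fin 4) K))) = Q := by
  ext x
  rw [Ideal.mem_comap, Ideal.mem_comap, ← translate_def, ← translate_def, PointBlowup.translate_neg_translate]

/-- **The `b`-coordinate ideals**: `τ_b⁻¹`-image of `(x_i : i ∈ T)` is `(x_i − b_i : i ∈ T)`, i.e.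
`(span (x_i : i ∈ T)).comap τ_b = span (x_i − b_i : i ∈ T)`. [folklore] -/
theorem comap_translate_span_X (b : Fin 4 → K) (T : Set (Fin 4)) :
    (Ideal.span ((fun i => (X i : MvPolynomial (Fin 4) K)) '' T)).comap
        (MvPolynomial.aeval (R := K) (fun i => (X i + C (b i) : MvPolynomial (Fin 4) K))) =
      Ideal.span ((fun i => (X i - C (b i) : MvPolynomial (Fin 4) K)) '' T) := by
  apply le_antisymm
  · intro x hx
    rw [Ideal.mem_comap, ← translate_def] at hx
    have hmap : (Ideal.span ((fun i => (X i : MvPolynomial (Fin 4) K)) '' T)).map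
        (MvPolynomial.aeval (R := K) (fun i => (X i + C (-b i) : MvPolynomial (Fin 4) K))) ≤
          Ideal.span ((fun i => (X i - C (b i) : MvPolynomial (Fin 4) K)) '' T) := by
      rw [Ideal.map_span, Ideal.span_le]
      rintro _ ⟨_, ⟨i, hi, rfl⟩, rfl⟩
      refine Ideal.subset_span ⟨i, hi, ?_⟩
      simp [sub_eq_add_neg]
    rw [← PointBlowup.translate_neg_translate b x, translate_def (fun i => -b i)]
    exact hmap (Ideal.mem_map_of_mem _ hx)
  · rw [Ideal.span_le]
    rintro _ ⟨i, hi, rfl⟩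
    rw [SetLike.mem_coe, Ideal.mem_comap, map_sub, aeval_X, aeval_C, algebraMap_eq, add_sub_cancel_right]
    exact Ideal.subset_span ⟨i, hi, rfl⟩

/-- Reading of the coordinate condition at `b`: `τ_b(Q)` is a coordinate ideal iff `Q = (x_i − b_i : i ∈ T)`
for some `T`. [folklore] -/
theorem isCoordinateIdeal_comap_translate_neg_iff (b : Fin 4 → K) (Q : Ideal (MvPolynomial (Fin 4) K)) :
    IsCoordinateIdeal (Q.comap (MvPolynomial.aeval (R := K) (fun i => (X i + C (-b i) : MvPolynomial (Fin 4) K)))) ↔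
      ∃ T : Finset (Fin 4), Q = Ideal.span ((fun i => (X i - C (b i) : MvPolynomial (Fin 4) K)) '' (T : Set (Fin 4))) := by
  constructor
  · rintro ⟨T, hT⟩
    refine ⟨T, ?_⟩
    rw [← comap_translate_comap_translate_neg b Q, hT, comap_translate_span_X]
  · rintro ⟨T, rfl⟩
    refine ⟨T, comap_translate_neg_injective (fun i => -b i) ?_⟩
    -- pull both sides back along `τ_b` (note `-(-b) = b`)
    have hb : (fun i => (X i + C (-(-b i)) : MvPolynomial (Fin 4) K)) = fun i => X i + C (b i) := by
      funext i; rw [neg_neg]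
    simp only [hb]
    rw [comap_translate_comap_translate_neg, comap_translate_span_X]

/-! ## §2 The step: `J_p⁺(child) = τ_b(J_p⁺(chart transform))` -/

section Step

variable [DecidableEq K] (p : ℕ) [Fact p.Prime] [CharP K p]

omit [Fact p.Prime] [CharP K p] in
/-- The child's residual polynomial (definitional): clean the translate of the chart transform. -/
theorem step_F_eq (S : Finset (Fin 4)) (j : Fin 4) (b : Fin 4 → K) (s : State K) :
    (CentreBlowup.step p S j b s).F =
      deletePthPowers p (PointBlowup.translate b (chartTransform p S j s.F)) :=
  rfl

/-- **`J_p⁺(F′) = τ_b(J_p⁺(G))`**, `G = chartTransform p S j F`, for EVERY edge `(S, j, b)`. [folklore] -/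
theorem singLocusIdeal_step (S : Finset (Fin 4)) (j : Fin 4) (b : Fin 4 → K) (s : State K) :
    singLocusIdeal p (CentreBlowup.step p S j b s).F =
      (singLocusIdeal p (chartTransform p S j s.F)).comap
        (MvPolynomial.aeval (R := K) (fun i => (X i + C (-b i) : MvPolynomial (Fin 4) K))) := by
  rw [step_F_eq, IsolatedBand.singLocusIdeal_deletePthPowers, singLocusIdeal_translate]

/-- At the chart origin: `J_p⁺(F′) = J_p⁺(G)`. [folklore] -/
theorem singLocusIdeal_step_origin (S : Finset (Fin 4)) (j : Fin 4) (s : State K) :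
    singLocusIdeal p (CentreBlowup.step p S j (0 : Fin 4 → K) s).F =
      singLocusIdeal p (chartTransform p S j s.F) := by
  rw [step_F_eq, IsolatedBand.singLocusIdeal_deletePthPowers, PointBlowup.translate_zero]

/-- **The components of the child's locus are the translates of the components of `V(J_p⁺(G))`.** [folklore] -/
theorem minimalPrimes_singLocusIdeal_step (S : Finset (Fin 4)) (j : Fin 4) (b : Fin 4 → K) (s : State K) :
    (singLocusIdeal p (CentreBlowup.step p S j b s).F).minimalPrimes =
      Ideal.comap (MvPolynomial.aeval (R := K) (fun i => (X i + C (-b i) : MvPolynomial (Fin 4) K))) ''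
        (singLocusIdeal p (chartTransform p S j s.F)).minimalPrimes := by
  rw [singLocusIdeal_step]
  exact Ideal.comap_minimalPrimes_eq_of_surjective (translate_neg_surjective b) _

/-- **CLASSIFICATION OF THE EDGE CHILD — SCOPE**: the child at the point `b` of the `x_j`-chart of the blow-up
of `V(z, x_S)` is in coordinate scope iff every component of `V(J_p⁺(G))` through `b`
(`G = chartTransform p S j F`) is, moved to the origin, a coordinate subspace — i.e. is `b + V(x_T)`
(`isCoordinateIdeal_comap_translate_neg_iff`). [folklore] -/
theorem inCoordinateScope_step_iff_chart (S : Finset (Fin 4)) (j : Fin 4) (b : Fin 4 → K) (s : State K) :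
    InCoordinateScope p (CentreBlowup.step p S j b s).F ↔
      ∀ Q ∈ (singLocusIdeal p (chartTransform p S j s.F)).minimalPrimes,
        Q ≤ RingHom.ker (MvPolynomial.eval b) →
          IsCoordinateIdeal
            (Q.comap (MvPolynomial.aeval (R := K) (fun i => (X i + C (-b i) : MvPolynomial (Fin 4) K)))) := by
  unfold InCoordinateScope
  rw [minimalPrimes_singLocusIdeal_step]
  constructor
  · intro h Q hQ hQb
    exact h _ ⟨Q, hQ, rfl⟩ ((comap_translate_neg_le_originIdeal_iff b Q).mpr hQb)
  · rintro h P ⟨Q, hQ, rfl⟩ hP0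
    exact h Q hQ ((comap_translate_neg_le_originIdeal_iff b Q).mp hP0)

/-- **Out of scope by one component**: a minimal prime of `J_p⁺(G)` through `b` that is not a `b`-coordinate
ideal `(x_i − b_i : i ∈ T)` puts the child at `b` out of scope. [folklore] -/
theorem not_inCoordinateScope_step_of_component (S : Finset (Fin 4)) (j : Fin 4) (b : Fin 4 → K)
    (s : State K) {Q : Ideal (MvPolynomial (Fin 4) K)}
    (hQ : Q ∈ (singLocusIdeal p (chartTransform p S j s.F)).minimalPrimes)
    (hQb : Q ≤ RingHom.ker (MvPolynomial.eval b))
    (hnc : ∀ T : Finset (Fin 4),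
      Q ≠ Ideal.span ((fun i => (X i - C (b i) : MvPolynomial (Fin 4) K)) '' (T : Set (Fin 4)))) :
    ¬ InCoordinateScope p (CentreBlowup.step p S j b s).F := fun h => by
  obtain ⟨T, hT⟩ := (isCoordinateIdeal_comap_translate_neg_iff b Q).mp
    ((inCoordinateScope_step_iff_chart p S j b s).mp h Q hQ hQb)
  exact hnc T hT

/-- **CLASSIFICATION OF THE EDGE CHILD — ISOLATION**: the child at `b` is an isolated `p`-fold point iff `b`
lies on `V(J_p⁺(G))` and the only component of `V(J_p⁺(G))` through `b` is the point `b`. [folklore] -/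
theorem isIsolated_step_iff_chart (S : Finset (Fin 4)) (j : Fin 4) (b : Fin 4 → K) (s : State K) :
    IsIsolated p (CentreBlowup.step p S j b s).F ↔
      singLocusIdeal p (chartTransform p S j s.F) ≤ RingHom.ker (MvPolynomial.eval b) ∧
        ∀ Q ∈ (singLocusIdeal p (chartTransform p S j s.F)).minimalPrimes,
          Q ≤ RingHom.ker (MvPolynomial.eval b) → Q = RingHom.ker (MvPolynomial.eval b) := by
  unfold IsIsolated
  rw [minimalPrimes_singLocusIdeal_step, singLocusIdeal_step, comap_translate_neg_le_originIdeal_iff]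
  refine and_congr_right fun _ => ⟨fun h Q hQ hQb => ?_, ?_⟩
  · apply comap_translate_neg_injective b
    rw [comap_translate_neg_ker_eval]
    exact h _ ⟨Q, hQ, rfl⟩ ((comap_translate_neg_le_originIdeal_iff b Q).mpr hQb)
  · rintro h P ⟨Q, hQ, rfl⟩ hP0
    rw [h Q hQ ((comap_translate_neg_le_originIdeal_iff b Q).mp hP0), comap_translate_neg_ker_eval]

/-- **DIV edges: off `V(x_j)` the components of `V(J_p⁺(G))` are the parent's** (part 2a read on the chart
transform `G = chartTransform p {j} j F`; clean `F`, permissible divisor). [folklore] -/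
theorem mem_minimalPrimes_chartTransform_iff_of_not_mem {j : Fin 4} (s : State K)
    (hclean : deletePthPowers p s.F = s.F) (hperm : (p : ℕ∞) ≤ ordAlong {j} s.F)
    {P : Ideal (MvPolynomial (Fin 4) K)} (hXP : (X j : MvPolynomial (Fin 4) K) ∉ P) :
    P ∈ (singLocusIdeal p (chartTransform p {j} j s.F)).minimalPrimes ↔
      P ∈ (singLocusIdeal p s.F).minimalPrimes := by
  rw [← singLocusIdeal_step_origin p {j} j s]
  exact mem_minimalPrimes_step_iff_of_not_mem p s hclean hperm hXP

end Step

end ScopeDynamics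

end Summit.ResolutionOfSingularities.ResolutionOfSingularities.Theorems.PIDim4

end
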